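import Summits.HodgeConjecture.HodgeConjecture.Theorems.F0P3cStCharTSSaHeadTorus4      -- ★ p850157 (this seat): head ₄ «Ω° CUT» ((TOR‴) on the trace-open core)
import Summits.HodgeConjecture.HodgeConjecture.Theorems.F0P3cStCharTSWeylCoreDensity   -- ★ (this seat): `weylIntegration_core_of_shells` — (WIF°) at `D_G = max(‖α‖, ‖α‖⁻¹)` from the shells
import Summits.HodgeConjecture.HodgeConjecture.Theorems.F0P3cStCharTSShellsTTLevels          -- ★ (LH6-p05 (g3)): «SHELLS-TT★» `exists_levels_shellsTT` + `shf_core` ((SHF′°) PROVED)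
import HarnessLib

/-!
# F0 · P3c · line LH6 «StCharTS» — «Sa-HEAD★» EDITION «(WIF)+(SHF′) OUT — CASSELMAN ONLY»: organ (S-a) with the split-torus package reduced to print's density `D_G = max(‖α‖, ‖α‖⁻¹)` and the two
# integrability sentences of [Rogawski1990, L. 12.7.2 (proof) p. 193] (road «W» = WEYL DISCHARGE, step (D))

Cell `pub/hodgecm-mathlib`, crux H413 = `stmt-HodgeConjecture-24833` (`--supports` lane, helper), route HCCMUnconditional; seat LH6-p01 (g3), integrator of the (TOR) road.
THEOREMS ONLY, sorry-free, ★-only imports.  THE STATEMENT `stSupportFiniteSqInt_of_carpet_torus₅` = ★ p850157 `stSupportFiniteSqInt_of_carpet_torus₄` with its hypothesis (TOR‴)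
«∃ w ∣ v, ∀ μM, (∃ ρ, (WIF°) ∧ (L1M) ∧ (L1M-up)) ∧ (SHF′°)» REPLACED by **(TOR⁗)** «∀ μM Haar on M, (L1M) ∧ (L1M-up)» with the density no longer
posited but EXPLICIT: `ρ(α, z) := max(‖α‖, ‖α‖⁻¹)` (`‖·‖ = unitModulusChar (E_v)`), i.e. print's `D_G` [L. 12.7.2 proof p. 193 «`D_G(γ) = ‖α‖⁻¹ = δ^{1∕2}(γ)⁻¹` for `‖α‖ < 1`»,
«`F_f(γ) = D_G(γ)Φ(γ, f)`» p. 191] = van Dijk's weight `Δ ∘ ι` off `M_c` (★ `vanDijkWeight_torusChart_of_not_mem`); all other texts VERBATIM.  GONE from the package, now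
THEOREMS in the tree: (WIF°) = ★ `weylIntegration_core_of_shells` (radial formula ★ p849950 + coset uniqueness ★ `…WeylCoreRadial` + the Hecke shells) fed by ★
«SHELLS-TT★» `exists_levels_shellsTT` (LH6-p05 (g3): the T1-levels Iwahori datum, ★ GValue two-coset orbital integrals, ★ DomBridge dominance, ★ shell masses);
(SHF′°) = ★ `shf_core` (LH6-p05 (g3), SURJ-HECKE road ★ `…SurjOmega` at `Ω := Ω°`).
PROOF.  The place `w ∣ v` exists (`PlacesOver L v` is non-empty); feed ★ p850157 with `ρ := max(‖·‖, ‖·‖⁻¹) ∘ pr₁`, (WIF°) := ★ `weylIntegration_core_of_shells … (★ shells)`,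
(L1M)(L1M-up) the hypotheses, (SHF′°) := ★ `shf_core`.
HONEST LABEL: HC_CM is proved only modulo the 7 printed citations (2 remaining: hLiu418 = stmt-HodgeConjecture-24832, h413 = stmt-HodgeConjecture-24833) until rung 0
closes; this edition DISCHARGES the Weyl-integration socket (and the posited density and the shell-surjectivity socket) of the (S-𝔇) package — the first
in-house discharge of an analytic conjunct of (TOR); the two Casselman sentences (L1M)(L1M-up) and the datum sockets remain print-named inputs.

## References
* [Rogawski1990] J. D. Rogawski, *Automorphic Representations of Unitary Groups in Three Variables*, Ann. of Math. Stud. 123 (1990): §12.5 pp. 182–183; §12.7 L. 12.7.1 (proof)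
  p. 191, L. 12.7.2 (proof) p. 193; §1.6 p. 5.
* [vanDijk1972] G. van Dijk, *Computation of certain induced characters of p-adic groups*, Math. Ann. 199 (1972), §2, Thm. p. 237.
* [Casselman1977] W. Casselman, *Characters and Jacquet modules*, Math. Ann. 230 (1977), Thm. 5.2.
-/

set_option autoImplicit false
-- the mandated namespace has the single-problem summit's repeated segment (`HodgeConjecture.HodgeConjecture`)
set_option linter.dupNamespace false

noncomputable section

open NumberField IsDedekindDomain MeasureTheory MeasureTheory.Measure Filter Topology
open scoped Matrix MatrixGroups BigOperators Pointwise NNReal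
open Literature.NumberTheory.Rogawski1990 Literature.NumberTheory.Automorphic Literature.NumberTheory.Automorphic.UnitaryGroup
open Literature.NumberTheory.GaloisRepresentations
open Literature.MeasureTheory.Group

namespace Summit.HodgeConjecture.HodgeConjecture.Cruxes.H413.F0P3cStCharTSSaHeadTorus5

open Literature.NumberTheory.Rogawski1990.Ch12Sec5
open Summit.HodgeConjecture.HodgeConjecture.Cruxes.H413.F0P3cStCharTSTorusDefs
open Summit.HodgeConjecture.HodgeConjecture.Cruxes.H413.F0P3cStCharTSWeylCoreDensity
open Summit.HodgeConjecture.HodgeConjecture.Cruxes.H413.F0P3cStCharTSShellsTTLevels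

set_option maxHeartbeats 1600000 in
-- the statement alone (≈ 240 lines of binders) exceeds the default budget; the proof is ★ p850157 + ★ `weylIntegration_core_of_shells` + ★ shells
/-- **«Sa-HEAD★» EDITION {title}** — organ (S-a) from the §12.5–12.6 datum (COMPAT 7), the TR carpets, the datum-level sockets incl. (CHAR-G), (SPLIT-NOT-ELL), and the
split-torus package (TOR⁗) = Casselman's integrability sentences at print's density `D_G = max(‖α‖, ‖α‖⁻¹)`. [cite: Rogawski1990, §12.7 Lemma 12.7.2 (proof) p. 193; §12.5 pp. 182–183;
§1.6 p. 5] [cite: Rogawski1990, §12.7 L. 12.7.1 (proof) p. 191] [cite: vanDijk1972, §2] -/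
theorem stSupportFiniteSqInt_of_carpet_torus₅ :
  ∀ (L : Type) [Field L] [NumberField L] [IsCMField L] (μ : HeckeCharacter L) (ξ : OneDimAutRepH L) (v : HeightOneSpectrum (𝓞 ↥(maximalRealSubfield L))),
    (∀ w : PlacesOver L v, IsCMField.complexConj L • w.1 = w.1) → μ.IsUnitary →
    (∀ x : Literature.NumberTheory.GaloisRepresentations.ideleGroup ↥(maximalRealSubfield L),
      μ (AdeleRing.ideleBaseChange (↥(maximalRealSubfield L)) L x) = quadraticHeckeCharCM L x) →
    ∀ [MeasurableSpace ((UnitaryGroup.cmDatum L 2 (Matrix.of fun i j : Fin 2 => if i.val + j.val + 1 = 2 then (1 : L) else 0)).Local v × (UnitaryGroup.cmDatum L 1 (Matrix.of fun i j : Fin 1 => if i.val + j.val + 1 = 1 then (1 : L) else 0)).Local v)] [BorelSpace ((UnitaryGroup.cmDatum L 2 (Matrix.of fun i j : Fin 2 => if i.val + j.val + 1 = 2 then (1 : L) else 0)).Local v × (UnitaryGroup.cmDatum L 1 (Matrix.of fun i j : Fin 1 => if i.val + j.val + 1 = 1 then (1 : L) else 0)).Local v)] [MeasurableSpace (Gqs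 L v)] [BorelSpace (Gqs L v)]
      (νHv : Measure ((UnitaryGroup.cmDatum L 2 (Matrix.of fun i j : Fin 2 => if i.val + j.val + 1 = 2 then (1 : L) else 0)).Local v × (UnitaryGroup.cmDatum L 1 (Matrix.of fun i j : Fin 1 => if i.val + j.val + 1 = 1 then (1 : L) else 0)).Local v)) (νQv : Measure (Gqs L v))
      [νHv.IsHaarMeasure] [νHv.IsMulRightInvariant] [νQv.IsHaarMeasure] [νQv.IsMulRightInvariant],
    letI : ∀ a : ((UnitaryGroup.cmDatum L 2 (Matrix.of fun i j : Fin 2 => if i.val + j.val + 1 = 2 then (1 : L) else 0)).Local v × (UnitaryGroup.cmDatum L 1 (Matrix.of fun i j : Fin 1 => if i.val + j.val + 1 = 1 then (1 : L) else 0)).Local v), MeasurableSpace (((UnitaryGroup.cmDatum L 2 (Matrix.of fun i j : Fin 2 => if i.val + j.val + 1 = 2 then (1 : L) else 0)).Local v × (UnitaryGroup.cmDatum L 1 (Matrix.of fun i j : Fin 1 => if i.val + j.val + 1 = 1 then (1 : L) else 0)).Local v) ⧸ Subgroup.centralizer ({a} : Set ((UnitaryGroup.cmDatum L 2 (Matrix.of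 fun i j : Fin 2 => if i.val + j.val + 1 = 2 then (1 : L) else 0)).Local v × (UnitaryGroup.cmDatum L 1 (Matrix.of fun i j : Fin 1 => if i.val + j.val + 1 = 1 then (1 : L) else 0)).Local v))) := fun _ => borel _
    haveI : ∀ a : ((UnitaryGroup.cmDatum L 2 (Matrix.of fun i j : Fin 2 => if i.val + j.val + 1 = 2 then (1 : L) else 0)).Local v × (UnitaryGroup.cmDatum L 1 (Matrix.of fun i j : Fin 1 => if i.val + j.val + 1 = 1 then (1 : L) else 0)).Local v), BorelSpace (((UnitaryGroup.cmDatum L 2 (Matrix.of fun i j : Fin 2 => if i.val + j.val + 1 = 2 then (1 : L) else 0)).Local v × (UnitaryGroup.cmDatum L 1 (Matrix.of fun i j : Fin 1 => if i.val + j.val + 1 = 1 then (1 : L) else 0)).Local v) ⧸ Subgroup.centralizer ({a} : Set ((UnitaryGroup.cmDatum L 2 (Matrix.of fun i j : Fin 2 => if i.val + j.val + 1 = 2 then (1 : L) else 0)).Local v × (UnitaryGroup.cmDatum L 1 (Matrix.of fun i j : Fin 1 => if i.val + j.val + 1 = 1 then (1 : L) else 0)).Local v))) := fun _ => ⟨r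fl⟩
    letI : ∀ γ : Gqs L v, MeasurableSpace (Gqs L v ⧸ Subgroup.centralizer ({γ} : Set (Gqs L v))) := fun _ => borel _
    haveI : ∀ γ : Gqs L v, BorelSpace (Gqs L v ⧸ Subgroup.centralizer ({γ} : Set (Gqs L v))) := fun _ => ⟨rfl⟩
    ∀ (mHv : OrbitalMeasureFamily ((UnitaryGroup.cmDatum L 2 (Matrix.of fun i j : Fin 2 => if i.val + j.val + 1 = 2 then (1 : L) else 0)).Local v × (UnitaryGroup.cmDatum L 1 (Matrix.of fun i j : Fin 1 => if i.val + j.val + 1 = 1 then (1 : L) else 0)).Local v)) (mQv : OrbitalMeasureFamily (Gqs L v)),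
      mHv.IsCanonical (IsLocalGRegular L v) νHv →
      mQv.IsCanonical (fun γ => IsRegularElt (γ.val : GL (Fin 3) (UnitaryGroup.LocalRing L v))) νQv →
      IsLocalDeltaTransferExists L (qsForm L) v ((finExplicitCollection L (qsForm L) μ (finExplicitDelta_conj_left_all L (qsForm L) μ) (finExplicitDelta_conj_right_all L (qsForm L) μ)) v) mHv mQv IsLocSmooth IsLocSmooth →
      ∀ (π₁ πSt : IrrClass ((UnitaryGroup.cmDatum L 2 (Matrix.of fun i j : Fin 2 => if i.val + j.val + 1 = 2 then (1 : L) else 0)).Local v × (UnitaryGroup.cmDatum L 1 (Matrix.of fun i j : Fin 1 => if i.val + j.val + 1 = 1 then (1 : L) else 0)).Local v)),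
        HLengthTwoLabels L v
          (torusCharPair (conjLocal L (IsCMField.complexConj L) v) (cmLocalForm L 2 v) (cmLocalForm_eq_over L 2 v) 0
            ((torusLocalComponent L (IsCMField.complexConj L) v ξ.η).comp
                (quotConj (conjLocal L (IsCMField.complexConj L) v) (conjLocal_conjLocal_cm L v)) *
              halfModulusChar (UnitaryGroup.LocalRing L v))
            (torusLocalComponent L (IsCMField.complexConj L) v ξ.ψ))
          ((torusLocalComponent L (IsCMField.complexConj L) v ξ.ψ).comp (localDet (IsCMField.complexConj L) v (isUnit_antidiagOne_det L 1))) π₁ πSt →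
        (∀ fH : ((UnitaryGroup.cmDatum L 2 (Matrix.of fun i j : Fin 2 => if i.val + j.val + 1 = 2 then (1 : L) else 0)).Local v × (UnitaryGroup.cmDatum L 1 (Matrix.of fun i j : Fin 1 => if i.val + j.val + 1 = 1 then (1 : L) else 0)).Local v) → ℂ, IsLocSmooth fH → π₁.smoothTrace νHv fH = charDist (ξ.xiLocalChar v) νHv fH) →
      ∀ [MeasurableSpace (Gqs L v ⧸ Subgroup.center (Gqs L v))] [BorelSpace (Gqs L v ⧸ Subgroup.center (Gqs L v))]
        (μZ : Measure (Gqs L v ⧸ Subgroup.center (Gqs L v))) [μZ.IsHaarMeasure],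
      -- ══ the §12.5–12.6 DATUM on the model (★ TR carpet, a BINDER) and its COMPATIBILITY with the organ's currency (byte-identical with ★ p848567 ∕ ★ p848673) ══
      ∀ (𝔇 : Ch12Sec5.EllipticData (Gqs L v) ((UnitaryGroup.cmDatum L 2 (Matrix.of fun i j : Fin 2 => if i.val + j.val + 1 = 2 then (1 : L) else 0)).Local v × (UnitaryGroup.cmDatum L 1 (Matrix.of fun i j : Fin 1 => if i.val + j.val + 1 = 1 then (1 : L) else 0)).Local v)),
      𝔇.μG = νQv → 𝔇.μH = νHv → 𝔇.μGZ = μZ → 𝔇.orb = mQv →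
      (∀ γ : Gqs L v, γ ∈ 𝔇.regG ↔ IsRegularElt (γ.val : GL (Fin 3) (UnitaryGroup.LocalRing L v))) →
      (∀ (φ : Gqs L v → ℂ) (fH : ((UnitaryGroup.cmDatum L 2 (Matrix.of fun i j : Fin 2 => if i.val + j.val + 1 = 2 then (1 : L) else 0)).Local v × (UnitaryGroup.cmDatum L 1 (Matrix.of fun i j : Fin 1 => if i.val + j.val + 1 = 1 then (1 : L) else 0)).Local v) → ℂ), 𝔇.IsTransfer φ fH ↔ IsLocalDeltaTransfer L (qsForm L) v ((finExplicitCollection L (qsForm L) μ (finExplicitDelta_conj_left_all L (qsForm L) μ) (finExplicitDelta_conj_right_all L (qsForm L) μ)) v) mHv mQv fH φ) →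
      ({πSt} : Finset (IrrClass ((UnitaryGroup.cmDatum L 2 (Matrix.of fun i j : Fin 2 => if i.val + j.val + 1 = 2 then (1 : L) else 0)).Local v × (UnitaryGroup.cmDatum L 1 (Matrix.of fun i j : Fin 1 => if i.val + j.val + 1 = 1 then (1 : L) else 0)).Local v))) ∈ 𝔇.sqPacketsH →
      -- ══ CARPET RELATIONS (named facts of ★ `Ch12Sec5` ∕ ★ `Ch12Sec6`, read at `𝔇`; union of ★ «Sa-COMPOSE» p848625 and ★ (R) p848976) ══
      𝔇.WeylIntegrationFormula → 𝔇.UpSpec → Ch12Sec6.PseudoCoeffExists 𝔇 → Ch12Sec6.PseudoCoeffTrace 𝔇 →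
      Ch12Sec6.Prop1261a 𝔇 → Ch12Sec6.Prop1261b 𝔇 → Ch12Sec6.Prop1261c 𝔇 →
      Ch12Sec6.LdsCharactersOpposite 𝔇 → Ch12Sec6.EllipticOfNotPrincipalSeries 𝔇 → Ch12Sec6.EllipticClassification 𝔇 →
      -- ══ PRINTED INPUTS NO CARPET STATES YET, in the socket shapes of LH6-p01's `Ch12Sec5Inputs` draft: (M1H) `PacketCharRegular`, (UPR) `UpRegular`, (ELL) `EllipticOfL2`,
      --    (DET) `DetNotL2`, (PIN) `PiNNotL2`, (LDS) `LdsNotL2`; and FIVE new sockets for the §12.7 (b)-row: (L2D∀) `D_G·χ_π ∈ L²(T)` for EVERY class, (U2) `D_G·χ_ρ^G ∈ L²(T)`,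
      --    (C1) `cartanG ⊆ cartanAll`, (C2) elliptic representatives a.e. in `G^e`, (C3) the other representatives a.e. in `G^r ∖ G^e` ══
      (∀ ρ ∈ 𝔇.sqPacketsH, Measurable (𝔇.packetCharH ρ) ∧ LocallyIntegrable (𝔇.packetCharH ρ) 𝔇.μH ∧
          Ch12Sec5.IsStableClassFunOn 𝔇.stConjH 𝔇.regH (𝔇.packetCharH ρ) ∧ Ch12Sec5.IsStableClassFunOn 𝔇.stConjH 𝔇.ellH (𝔇.packetCharH ρ) ∧
          ∀ fH : ((UnitaryGroup.cmDatum L 2 (Matrix.of fun i j : Fin 2 => if i.val + j.val + 1 = 2 then (1 : L) else 0)).Local v × (UnitaryGroup.cmDatum L 1 (Matrix.of fun i j : Fin 1 => if i.val + j.val + 1 = 1 then (1 : L) else 0)).Local v) → ℂ, IsLocSmooth fH → (∑ σ ∈ ρ, σ.smoothTrace 𝔇.μH fH) = ∫ h, fH h * 𝔇.packetCharH ρ h ∂𝔇.μH) →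
      (∀ ρ ∈ 𝔇.sqPacketsH, LocallyIntegrable (𝔇.up (𝔇.packetCharH ρ)) 𝔇.μG ∧
          ∀ x ∈ 𝔇.regG, ∀ᶠ y in 𝓝 x, 𝔇.up (𝔇.packetCharH ρ) y = 𝔇.up (𝔇.packetCharH ρ) x) →
      (∀ π : IrrClass (Gqs L v), 𝔇.IsL2 π → 𝔇.IsEllipticRep π) →
      (∀ ψ : ↥(Subgroup.center (Gqs L v)) →* ℂˣ, Continuous ψ → ¬ 𝔇.IsL2 (𝔇.detG ψ)) →
      (∀ ξ' : ((UnitaryGroup.cmDatum L 2 (Matrix.of fun i j : Fin 2 => if i.val + j.val + 1 = 2 then (1 : L) else 0)).Local v × (UnitaryGroup.cmDatum L 1 (Matrix.of fun i j : Fin 1 => if i.val + j.val + 1 = 1 then (1 : L) else 0)).Local v) →* ℂˣ, Continuous ξ' → ¬ 𝔇.IsL2 (𝔇.piN ξ')) →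
      (∀ P ∈ 𝔇.ldsPackets, ∀ σ ∈ P, ¬ 𝔇.IsL2 σ) →
      (∀ π : IrrClass (Gqs L v), ∀ T ∈ 𝔇.cartanG, MemLp (fun t : ↥T => (𝔇.DG (t : Gqs L v) : ℂ) * 𝔇.char π (t : Gqs L v)) 2 (𝔇.μT T)) →
      (∀ ρ ∈ 𝔇.sqPacketsH, ∀ T ∈ 𝔇.cartanG, MemLp (fun t : ↥T => (𝔇.DG (t : Gqs L v) : ℂ) * 𝔇.up (𝔇.packetCharH ρ) (t : Gqs L v)) 2 (𝔇.μT T)) →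
      𝔇.cartanG ⊆ 𝔇.cartanAll →
      (∀ T ∈ 𝔇.cartanG, ∀ᵐ t : ↥T ∂(𝔇.μT T), (t : Gqs L v) ∈ 𝔇.ellG) →
      (∀ T ∈ 𝔇.cartanAll, T ∉ 𝔇.cartanG → ∀ᵐ t : ↥T ∂(𝔇.μT T), (t : Gqs L v) ∈ 𝔇.regG ∧ (t : Gqs L v) ∉ 𝔇.ellG) →
      -- ══ further datum-level sockets of ★ (R) p848976: (LDSE) (LDSU) (LDS2) (R0) (MATE-UNIQ) (ST-L2) (PI2-L2) — (SC-L2) «supercuspidal ⇒ square-integrable» is DISCHARGED below (compact centre at the non-split `v`) ══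
      (∀ P ∈ 𝔇.ldsPackets, ∀ σ ∈ P, 𝔇.IsEllipticRep σ) →
      (∀ P ∈ 𝔇.ldsPackets, ∀ π' ∈ P, ∀ π : IrrClass (Gqs L v), π ∉ P → ¬ 𝔇.IsEllipticPair π π') →
      (∀ P ∈ 𝔇.ldsPackets, ∀ σ ∈ P, ∃ σ' ∈ P, σ' ≠ σ ∧ ∀ τ ∈ P, τ = σ ∨ τ = σ') →
      (∀ P ∈ 𝔇.ldsPackets, ∀ π' ∈ P, ∀ f : Gqs L v → ℂ, 𝔇.IsPseudoCoeff π' f → ∀ fH : ((UnitaryGroup.cmDatum L 2 (Matrix.of fun i j : Fin 2 => if i.val + j.val + 1 = 2 then (1 : L) else 0)).Local v × (UnitaryGroup.cmDatum L 1 (Matrix.of fun i j : Fin 1 => if i.val + j.val + 1 = 1 then (1 : L) else 0)).Local v) → ℂ, IsLocSmooth fH → 𝔇.IsTransfer f fH →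
          (∑ σ ∈ ({πSt} : Finset (IrrClass ((UnitaryGroup.cmDatum L 2 (Matrix.of fun i j : Fin 2 => if i.val + j.val + 1 = 2 then (1 : L) else 0)).Local v × (UnitaryGroup.cmDatum L 1 (Matrix.of fun i j : Fin 1 => if i.val + j.val + 1 = 1 then (1 : L) else 0)).Local v))), σ.smoothTrace 𝔇.μH fH) = 0) →
      (∀ σ u u' : IrrClass (Gqs L v), 𝔇.IsL2 σ → ¬ 𝔇.IsL2 u → ¬ 𝔇.IsL2 u' → 𝔇.IsEllipticPair u σ → 𝔇.IsEllipticPair u' σ → u = u') →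
      (∀ ψ' : ↥(Subgroup.center (Gqs L v)) →* ℂˣ, Continuous ψ' → 𝔇.IsL2 (𝔇.stG ψ')) →
      (∀ ξ' : ((UnitaryGroup.cmDatum L 2 (Matrix.of fun i j : Fin 2 => if i.val + j.val + 1 = 2 then (1 : L) else 0)).Local v × (UnitaryGroup.cmDatum L 1 (Matrix.of fun i j : Fin 1 => if i.val + j.val + 1 = 1 then (1 : L) else 0)).Local v) →* ℂˣ, Continuous ξ' → 𝔇.IsL2 (𝔇.pi2 ξ')) →
      -- ══ THE PRINCIPAL SERIES OF THE NON-SQUARE-INTEGRABLE CLASSES [§12.2]: a parameter map `par` into the tree's PAIR currency, with (PS1) (PS2) (PS3)=(JHL) (NONL2-PAR) (UNIQ-PAR) ══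
      ∀ (par : IrrClass (Gqs L v) → (((UnitaryGroup.LocalRing L v)ˣ →* ℂˣ) × (↥(normOneUnits (conjLocal L (IsCMField.complexConj L) v)) →* ℂˣ))),
      (∀ π ∈ 𝔇.irredPS, ¬ 𝔇.IsL2 π → ∀ f : Gqs L v → ℂ, IsLocSmooth f → π.smoothTrace νQv f = Representation.smoothTrace (G := Gqs L v) (UnitaryGroup.cmPrincipalSeries L 3 v (UnitaryGroup.cmTorusCharPair L v (par π).1 (par π).2)) νQv f) →
      (∀ π σ : IrrClass (Gqs L v), ¬ 𝔇.IsL2 π → 𝔇.IsL2 σ → 𝔇.IsEllipticPair π σ → ∀ f : Gqs L v → ℂ, IsLocSmooth f →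
          π.smoothTrace νQv f + σ.smoothTrace νQv f = Representation.smoothTrace (G := Gqs L v) (UnitaryGroup.cmPrincipalSeries L 3 v (UnitaryGroup.cmTorusCharPair L v (par π).1 (par π).2)) νQv f) →
      (∀ P ∈ 𝔇.ldsPackets, ∀ π' ∈ P, ∀ π'' ∈ P, π' ≠ π'' → par π'' = par π' ∧ ∀ f : Gqs L v → ℂ, IsLocSmooth f →
          π'.smoothTrace νQv f + π''.smoothTrace νQv f = Representation.smoothTrace (G := Gqs L v) (UnitaryGroup.cmPrincipalSeries L 3 v (UnitaryGroup.cmTorusCharPair L v (par π').1 (par π').2)) νQv f) →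
      (∀ π : IrrClass (Gqs L v), ¬ 𝔇.IsL2 π →
          π.IsConstituentOf (UnitaryGroup.cmPrincipalSeries L 3 v (UnitaryGroup.cmTorusCharPair L v (par π).1 (par π).2)) ∧
            Continuous (par π).1 ∧ Continuous (par π).2) →
      (∀ u u' : IrrClass (Gqs L v), ¬ 𝔇.IsL2 u → ¬ 𝔇.IsL2 u' →
          (par u' = par u ∨ par u' = (conjInvChar (conjLocal L (IsCMField.complexConj L) v) (par u).1, (par u).2)) →
          u' = u ∨ ∃ P ∈ 𝔇.ldsPackets, u ∈ P ∧ u' ∈ P) →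
      -- ══ LH6-p05's split-torus block in place of §1's binder `hF` (★ F3′ p849140's sockets, ∀-forms) ══
      -- ══ (SPLIT-NOT-ELL) «a REGULAR element of the split torus `T ⊂ U(Φ₃)(L⁺_v)` is not in `G^e`» [§12.5 p. 184] — the structural socket that ★ «PSE★» `F0P3cStCharTSPsePseudo` trades (PSE) for ══
      (∀ t : ↥(cmBorelTriple L 3 v).M, IsRegularElt ((((t : ↥(unitaryGroupOfForm (conjLocal L (IsCMField.complexConj L) v) (cmLocalForm L 3 v))) : Gqs L v).val : GL (Fin 3) (UnitaryGroup.LocalRing L v))) → ((t : ↥(unitaryGroupOfForm (conjLocal L (IsCMField.complexConj L) v) (cmLocalForm L 3 v))) : Gqs L v) ∉ 𝔇.ellG) →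
      -- ══ (CHAR-G) Harish-Chandra: the character `χ_π` of EVERY `π ∈ E(G)` is a locally integrable class function on `G^r` representing the trace on `C_c^∞(G)` [§1.6 p. 5] —
      --    the `G`-twin of (M1H), a datum-level socket on the datum's `char` ══
      (∀ π : IrrClass (Gqs L v), Measurable (𝔇.char π) ∧ LocallyIntegrable (𝔇.char π) 𝔇.μG ∧ Ch12Sec5.IsClassFunOn 𝔇.regG (𝔇.char π) ∧
          ∀ φ : Gqs L v → ℂ, IsLocSmooth φ → π.smoothTrace 𝔇.μG φ = ∫ g, φ g * 𝔇.char π g ∂𝔇.μG) →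
      -- ══ (TOR⁗) THE SPLIT-TORUS PACKAGE WITH THE WEYL SOCKET DISCHARGED: for EVERY Haar measure `μM` on `M = E_vˣ × E¹_v` (Borel σ-algebra at statement level),
      --    Casselman's two integrability sentences at PRINT'S DENSITY `D_G(α, z) = max(‖α‖, ‖α‖⁻¹)` («`F_f(γ) = D_G(γ)Φ(γ, f)`», «`D_G(γ) = ‖α‖⁻¹` for `‖α‖ < 1`»):
      --    (L1M) «for all square-integrable `π`, the restriction of `D_G(γ)χ_π(γ)` to `M` is an integrable function» [L. 12.7.2 proof p. 193] and (L1M-up) the same for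
      --    `D_G·χ_ρ^G`, `ρ = St_H(ξ_v)` [L. 12.5.1 p. 183; p. 193].  The Weyl integration formula (WIF°) is now the THEOREM ★ `…WeylCoreDensity.weylIntegration_core_of_shells`
      --    over ★ `…ShellsTT` (Hecke shells); the shell surjectivity (SHF′°) is the THEOREM ★ `shf_core` — so NO Weyl-side socket remains ══
      (letI : MeasurableSpace ((UnitaryGroup.LocalRing L v)ˣ × ↥(normOneUnits (conjLocal L (IsCMField.complexConj L) v))) := borel _
      haveI : BorelSpace ((UnitaryGroup.LocalRing L v)ˣ × ↥(normOneUnits (conjLocal L (IsCMField.complexConj L) v))) := ⟨rfl⟩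
      ∀ (μM : Measure ((UnitaryGroup.LocalRing L v)ˣ × ↥(normOneUnits (conjLocal L (IsCMField.complexConj L) v)))) [μM.IsHaarMeasure],
        -- (L1M) `D_G χ_σ|_M ∈ L¹(M)` for every square-integrable `σ` [p. 193]
        (∀ σ : IrrClass (Gqs L v), σ.IsSquareIntegrable μZ → Integrable (fun m => ((((max (unitModulusChar (UnitaryGroup.LocalRing L v) m.1) (unitModulusChar (UnitaryGroup.LocalRing L v) m.1)⁻¹ : ℝ≥0)) : ℝ) : ℂ) * 𝔇.char σ (((torusChart L v m : ↥(cmBorelTriple L 3 v).M) : ↥(unitaryGroupOfForm (conjLocal L (IsCMField.complexConj L) v) (cmLocalForm L 3 v))) : Gqs L v)) μM) ∧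
        -- (L1M-up) `D_G χ_ρ^G|_M ∈ L¹(M)` for `ρ = St_H(ξ_v)` [L. 12.5.1 p. 183; p. 193]
        Integrable (fun m => ((((max (unitModulusChar (UnitaryGroup.LocalRing L v) m.1) (unitModulusChar (UnitaryGroup.LocalRing L v) m.1)⁻¹ : ℝ≥0)) : ℝ) : ℂ) * 𝔇.up (𝔇.packetCharH {πSt}) (((torusChart L v m : ↥(cmBorelTriple L 3 v).M) : ↥(unitaryGroupOfForm (conjLocal L (IsCMField.complexConj L) v) (cmLocalForm L 3 v))) : Gqs L v)) μM) →
      ∀ aX : IrrClass (Gqs L v) → ℤ, (Function.support aX).Countable →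
        (∀ π : IrrClass (Gqs L v), aX π ≠ 0 → π.IsUnitarizable) →
        (∀ (fH : ((UnitaryGroup.cmDatum L 2 (Matrix.of fun i j : Fin 2 => if i.val + j.val + 1 = 2 then (1 : L) else 0)).Local v × (UnitaryGroup.cmDatum L 1 (Matrix.of fun i j : Fin 1 => if i.val + j.val + 1 = 1 then (1 : L) else 0)).Local v) → ℂ) (φ : Gqs L v → ℂ), IsLocSmooth fH → IsLocSmooth φ →
            IsLocalDeltaTransfer L (qsForm L) v ((finExplicitCollection L (qsForm L) μ (finExplicitDelta_conj_left_all L (qsForm L) μ) (finExplicitDelta_conj_right_all L (qsForm L) μ)) v) mHv mQv fH φ →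
            Summable (fun π : IrrClass (Gqs L v) => (aX π : ℂ) * π.smoothTrace νQv φ) ∧
              ∑' π : IrrClass (Gqs L v), (aX π : ℂ) * π.smoothTrace νQv φ = πSt.smoothTrace νHv fH) →
        (Function.support aX).Finite ∧ ∀ π : IrrClass (Gqs L v), aX π ≠ 0 → π.IsSquareIntegrable μZ := by

  intro L _ _ _ μ ξ v hns hμu hμω _ _ _ _ νHv νQv _ _ _ _ mHv mQv hcanH hcanQ hTv π₁ πSt hHL hπ₁ _ _ μZ _
    𝔇 hμG hμH hμGZ horb hreg hTr hρ hW hUp hPCE hPCT h61a h61b h61c hLO hEONPS hEC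
    hHCH hUpReg hEll hDet hPiN hLds hL2domAll hUdom hsub hTell hTnon
    hLdsE hLdsU hLds2 hR0 hMU hStL2 hPi2L2
    par hPS1 hPS2 hPS3 hNP hUP
    hsplit hCH hTOR
    aX hcnt hunit hid
  -- the organ's quotient σ-algebras and the Borel structure of `M`, re-installed as local instances
  letI : ∀ γ : Gqs L v, MeasurableSpace (Gqs L v ⧸ Subgroup.centralizer ({γ} : Set (Gqs L v))) := fun _ => borel _
  haveI : ∀ γ : Gqs L v, BorelSpace (Gqs L v ⧸ Subgroup.centralizer ({γ} : Set (Gqs L v))) := fun _ => ⟨rfl⟩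
  letI : MeasurableSpace ((UnitaryGroup.LocalRing L v)ˣ × ↥(normOneUnits (conjLocal L (IsCMField.complexConj L) v))) := borel _
  haveI : BorelSpace ((UnitaryGroup.LocalRing L v)ˣ × ↥(normOneUnits (conjLocal L (IsCMField.complexConj L) v))) := ⟨rfl⟩
  obtain ⟨w⟩ : Nonempty (PlacesOver L v) := inferInstance
  refine F0P3cStCharTSSaHeadTorus4.stSupportFiniteSqInt_of_carpet_torus₄ L μ ξ v hns hμu hμω νHv νQv mHv mQv hcanH hcanQ hTv π₁ πSt hHL hπ₁ μZ
    𝔇 hμG hμH hμGZ horb hreg hTr hρ hW hUp hPCE hPCT h61a h61b h61c hLO hEONPS hEC hHCH hUpReg hEll hDet hPiN hLds hL2domAll hUdom hsub hTell hTnon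
    hLdsE hLdsU hLds2 hR0 hMU hStL2 hPi2L2 par hPS1 hPS2 hPS3 hNP hUP hsplit hCH ⟨w, fun μM _ => ?_⟩ aX hcnt hunit hid
  obtain ⟨hL1, hL1up⟩ := hTOR μM
  obtain ⟨Mlev, hMo, hMa, hMb, hM0, hMr, hSH⟩ := exists_levels_shellsTT L v hns w νQv hcanQ μM
  exact ⟨⟨(fun m : ((UnitaryGroup.LocalRing L v)ˣ × ↥(normOneUnits (conjLocal L (IsCMField.complexConj L) v))) => (((max (unitModulusChar (UnitaryGroup.LocalRing L v) m.1) (unitModulusChar (UnitaryGroup.LocalRing L v) m.1)⁻¹ : ℝ≥0)) : ℝ)), weylIntegration_core_of_shells L v hns w νQv hcanQ μM Mlev hMo hMa hMb hM0 hMr hSH, hL1, hL1up⟩,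
    shf_core L v hns w νQv hcanQ μM⟩

end Summit.HodgeConjecture.HodgeConjecture.Cruxes.H413.F0P3cStCharTSSaHeadTorus5

end
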